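import Literature.Probability.Percolation.InequalitiesProofs
import HarnessLib

/-!
# Configuration-versus-complement connection patterns on a finite multigraph (folding fibres)

Topic `Literature/Probability/Percolation`; definitions with bodies and one theorem, no named facts.

For a product measure `μ` on `{0,1}^E` and events `A, B`, the product `μ(A) μ(B) = (μ × μ)(A × B)`
decomposes over the *foldings* of van den Berg–Gandolfi (*Probab. Theory Related Fields* 157
(2013), Def. 12 and the display on p. 165; the same grouping is used by van den Berg–Fiebig 1987 and
Reimer 2000): one sums, over the "locked area" `M ⊆ E` on which the two copies agree and their
common value `α` there, the number of `ω ∈ {0,1}^{E ∖ M}` with `α ∘ ω ∈ A` and `α ∘ ω̄ ∈ B`, where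
`ω̄` is the coordinatewise complement. For connection events the fibre count is a count on the
multigraph `H` obtained by contracting the `α`-open and deleting the `α`-closed locked edges:
the number of `ω ⊆ E(H)` such that `ω` has one connection pattern and its COMPLEMENT `E(H) ∖ ω` has
another. This file sets up that vocabulary for a finite multigraph given by an edge-label type
`α` and an endpoint map `ends : α → Sym2 V` (parallel edges allowed), and proves the one
configuration-versus-complement counting inequality that follows from Reimer's butterfly theorem
(`reimer_flip_card_le`, `|A □ B| ≤ |A ∩ B̄|`, Reimer 2000 Thm. 1.2 = van den Berg–Gandolfi 2013
Prop. 2), for the four-terminal "crossing versus tripod" patterns: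

* `labelledOpen ends z` — the set of open edges `{ends a | z a = true}` of a labelled configuration
  `z : α → Bool`; `(openGraph (labelledOpen ends z)).Reachable` is open connection in `H`, and
  `labelledOpen ends (fun a => !z a)` is the complementary (closed) configuration.
* `crossComplCount ends o x y w` — `N_L(H) = #{ω : ω ∈ ox|yw, ω̄ ∈ oy|xw}` (crossing `2|2` cells of
  the partition of `{o,x,y,w}` in `ω` and in its complement).
* `tripodComplCount ends o x y w` — `N_R(H) = #{ω : ω ∈ oxw|y, ω̄ ∈ oyw|x}` (complementary tripods).
* `tripodComplRelaxedCount ends o x y w` — `N_R⁺(H) = #{ω : o ↔ x ↔ w in ω, o ↔ y ↔ w in ω̄}`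
  (the tripod connections without the separation of the fourth terminal).
* `crossComplCount_le_tripodComplRelaxedCount` — **`N_L(H) ≤ N_R⁺(H)`**: with
  `A₀ = {o ↔ x open, o ↔ y closed}`, `B₀ = {y ↔ w open, x ↔ w closed}` one has
  `{ox|yw} ∩ ι{oy|xw} ⊆ A₀ □ B₀` (the open `o–x` path and the closed `o–y` path certify `A₀`; they
  are edge-disjoint from the open `y–w` and closed `x–w` paths because `o ≁ y` in `ω` and `o ≁ x`
  in `ω̄`), Reimer's `|A₀ □ B₀| ≤ |A₀ ∩ B̄₀|`, and `A₀ ∩ B̄₀ = {o ↔ x ↔ w open, o ↔ y ↔ w closed}`.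

Summing `N_R − N_L` over the folding fibres with the fibre weights gives
`P{oxw|y} P{oyw|x} − P{ox|yw} P{oy|xw}` (the tripod exchange `tripodExchange`, a theorem via
van den Berg–Häggström–Kahn 2006); the fibrewise inequality `N_L(H) ≤ N_R(H)` for every finite
multigraph — equivalently Bernstein-nonnegativity of that difference in multidegree `(2,…,2)` — is
NOT known (harness notes, 2026-08: no counterexample among all multigraphs with `n ≤ 7` vertices and
few edges); only the relaxed form proved here follows from Reimer's theorem.

## References

* D. Reimer, *Proof of the van den Berg–Kesten conjecture*, Combin. Probab. Comput. 9 (2000) 27–32,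
  Thm. 1.2 [ReimerCPC2000].
* J. van den Berg, A. Gandolfi, *BK-type inequalities and generalized random-cluster
  representations*, Probab. Theory Related Fields 157 (2013) 157–181, §1 Prop. 2, §3 Def. 12
  [VandenbergGandolfi2012].
* G. Grimmett, *Percolation*, 2nd ed. (1999), §2.3, Thm. (2.19) [GrimmettPercolation1999].

## Mathlib / tree

Tree: `reimer_flip_card_le` (`InequalitiesProofs.lean`), `openGraph`, `openConn`
(`Percolation.lean`). Mathlib: `SimpleGraph.Walk.transfer`, `SimpleGraph.Walk.takeUntil`.
-/

namespace Literature.Probability.Percolation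

open Finset

variable {V α : Type*}

/-! ### Labelled (multigraph) configurations -/

/-- The set of open edges of a labelled configuration `z : α → Bool` of a multigraph with endpoint
map `ends : α → Sym2 V`: the edge `e` is open iff SOME label `a` with `ends a = e` has `z a = true`
(so `openGraph (labelledOpen ends z)` is the open subgraph of the multigraph; loops are ignored by
`openGraph`). The complementary configuration is `fun a => !z a`.
(van den Berg–Gandolfi 2013, §3, configurations `α ∘ ω` and `α ∘ ω̄` on a folding fibre.) [cite: VandenbergGandolfi2012, §3 Def. 12] -/
def labelledOpen (ends : α → Sym2 V) (z : α → Bool) : BondConfig V :=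
  {e | ∃ a, z a = true ∧ ends a = e}

/-- An edge of the open graph of a labelled configuration carries an open label.
(van den Berg–Gandolfi 2013, §3.) [folklore] -/
theorem exists_label_of_mem_edgeSet (ends : α → Sym2 V) (z : α → Bool) {e : Sym2 V}
    (he : e ∈ (openGraph (labelledOpen ends z)).edgeSet) : ∃ a, z a = true ∧ ends a = e := by
  rw [openGraph, SimpleGraph.edgeSet_fromEdgeSet] at he
  exact he.1

/-- Conversely, an open label on a non-loop edge puts it in the open graph.
(van den Berg–Gandolfi 2013, §3.) [folklore] -/
theorem mem_edgeSet_of_label (ends : α → Sym2 V) (z : α → Bool) {a : α} (ha : z a = true)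
    (hd : ¬ (ends a).IsDiag) : ends a ∈ (openGraph (labelledOpen ends z)).edgeSet := by
  rw [openGraph, SimpleGraph.edgeSet_fromEdgeSet]
  exact ⟨⟨a, ha, rfl⟩, hd⟩

/-- Transfer of an open walk: if `z'` is open on every `z`-open label of an edge of the walk `p` in
the open graph of `z`, then `p` is a walk in the open graph of `z'`.
(van den Berg–Gandolfi 2013, §3; Grimmett 1999 §2.3, cylinder events.) [folklore] -/
theorem reachable_of_walk_of_labels (ends : α → Sym2 V) (z z' : α → Bool) {u v : V}
    (p : (openGraph (labelledOpen ends z)).Walk u v)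
    (h : ∀ a, z a = true → ends a ∈ p.edges → z' a = true) :
    (openGraph (labelledOpen ends z')).Reachable u v := by
  refine ⟨p.transfer (openGraph (labelledOpen ends z')) fun e he => ?_⟩
  have heG := p.edges_subset_edgeSet he
  obtain ⟨a, ha, rfl⟩ := exists_label_of_mem_edgeSet ends z heG
  have hd : ¬ (ends a).IsDiag := by
    rw [openGraph, SimpleGraph.edgeSet_fromEdgeSet] at heG
    exact heG.2
  exact mem_edgeSet_of_label ends z' (h a ha he) hd

/-- Two open walks sharing an edge have connected starting points.
(Grimmett 1999, §2.3.) [folklore] -/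
theorem reachable_of_mem_edges_of_mem_edges [DecidableEq V] {G : SimpleGraph V} {u v u' v' : V}
    (p : G.Walk u v) (q : G.Walk u' v') {e : Sym2 V} (hp : e ∈ p.edges) (hq : e ∈ q.edges) :
    G.Reachable u u' := by
  induction e using Sym2.ind with
  | h s t =>
    have hs : s ∈ p.support := p.fst_mem_support_of_mem_edges hp
    have hs' : s ∈ q.support := q.fst_mem_support_of_mem_edges hq
    exact ⟨(p.takeUntil s hs).append (q.takeUntil s hs').reverse⟩

/-! ### The configuration-versus-complement pattern counts -/

section Counts

variable [Fintype α] [DecidableEq α]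

open Classical in
/-- **`N_L(H)`**: the number of configurations `ω` of the multigraph `(V, α, ends)` such that the
open-cluster partition of `{o,x,y,w}` in `ω` is `ox|yw` (`o ↔ x`, `y ↔ w`, `o ↮ y`) and in the
COMPLEMENT `ω̄` it is `oy|xw` — the folding-fibre count of the pair of events
(`{ox|yw}`, `{oy|xw}`). (van den Berg–Gandolfi 2013, §3 Def. 12 and eq. (gen-alt-rhs), specialised
to partition events.) [cite: VandenbergGandolfi2012, §3 Def. 12] -/
noncomputable def crossComplCount (ends : α → Sym2 V) (o x y w : V) : ℕ :=
  (univ.filter fun z : α → Bool =>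
    (openGraph (labelledOpen ends z)).Reachable o x ∧
    (openGraph (labelledOpen ends z)).Reachable y w ∧
    ¬ (openGraph (labelledOpen ends z)).Reachable o y ∧
    (openGraph (labelledOpen ends fun a => !z a)).Reachable o y ∧
    (openGraph (labelledOpen ends fun a => !z a)).Reachable x w ∧
    ¬ (openGraph (labelledOpen ends fun a => !z a)).Reachable o x).card

open Classical in
/-- **`N_R(H)`**: the number of configurations `ω` with open partition `oxw|y` (`o ↔ x ↔ w`,
`o ↮ y`) whose complement has partition `oyw|x` — the folding-fibre count of the pair
(`{oxw|y}`, `{oyw|x}`). (van den Berg–Gandolfi 2013, §3 Def. 12.) [cite: VandenbergGandolfi2012, §3 Def. 12] -/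
noncomputable def tripodComplCount (ends : α → Sym2 V) (o x y w : V) : ℕ :=
  (univ.filter fun z : α → Bool =>
    (openGraph (labelledOpen ends z)).Reachable o x ∧
    (openGraph (labelledOpen ends z)).Reachable x w ∧
    ¬ (openGraph (labelledOpen ends z)).Reachable o y ∧
    (openGraph (labelledOpen ends fun a => !z a)).Reachable o y ∧
    (openGraph (labelledOpen ends fun a => !z a)).Reachable y w ∧
    ¬ (openGraph (labelledOpen ends fun a => !z a)).Reachable o x).card

open Classical in
/-- **`N_R⁺(H)`**: the number of configurations `ω` with `o ↔ x ↔ w` open and `o ↔ y ↔ w` closed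
(the tripod connections of `tripodComplCount` without the separation of the fourth terminal) —
the folding-fibre count of (`{o ↔ x ↔ w}`, `{o ↔ y ↔ w}`). (van den Berg–Gandolfi 2013, §3
Def. 12.) [cite: VandenbergGandolfi2012, §3 Def. 12] -/
noncomputable def tripodComplRelaxedCount (ends : α → Sym2 V) (o x y w : V) : ℕ :=
  (univ.filter fun z : α → Bool =>
    (openGraph (labelledOpen ends z)).Reachable o x ∧
    (openGraph (labelledOpen ends z)).Reachable x w ∧
    (openGraph (labelledOpen ends fun a => !z a)).Reachable o y ∧
    (openGraph (labelledOpen ends fun a => !z a)).Reachable y w).card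

/-- `N_R(H) ≤ N_R⁺(H)` (dropping the two separation conditions). [folklore] -/
theorem tripodComplCount_le_tripodComplRelaxedCount (ends : α → Sym2 V) (o x y w : V) :
    tripodComplCount ends o x y w ≤ tripodComplRelaxedCount ends o x y w := by
  classical
  unfold tripodComplCount tripodComplRelaxedCount
  refine card_le_card fun z hz => ?_
  simp only [mem_filter, mem_univ, true_and] at hz ⊢
  exact ⟨hz.1, hz.2.1, hz.2.2.2.1, hz.2.2.2.2.1⟩

omit [DecidableEq α] in
/-- **The crossing patterns lie in `A₀ □ B₀`** (cube form of disjoint occurrence used by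
`reimer_flip_card_le`): if `ω ∈ ox|yw` and `ω̄ ∈ oy|xw` then the labels of an open `o–x` path and of
a closed `o–y` path form an index set `K` with `[ω]_K ⊆ A₀ = {o ↔ x open, o ↔ y closed}` and
`[ω]_{Kᶜ} ⊆ B₀ = {y ↔ w open, x ↔ w closed}`: an open `y–w` path avoids `K` because a common
edge with the open `o–x` path would join `o` to `y` in `ω`, and a closed `x–w` path avoids `K`
because a common edge with the closed `o–y` path would join `o` to `x` in `ω̄`.
(Reimer 2000, §1; van den Berg–Gandolfi 2013, §3, witnesses on a folding fibre.) [cite: VandenbergGandolfi2012, §3] -/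
theorem exists_witness_of_cross [DecidableEq V] (ends : α → Sym2 V) (o x y w : V)
    (z : α → Bool)
    (hox : (openGraph (labelledOpen ends z)).Reachable o x)
    (hyw : (openGraph (labelledOpen ends z)).Reachable y w)
    (hoy : ¬ (openGraph (labelledOpen ends z)).Reachable o y)
    (hoy' : (openGraph (labelledOpen ends fun a => !z a)).Reachable o y)
    (hxw' : (openGraph (labelledOpen ends fun a => !z a)).Reachable x w)
    (hox' : ¬ (openGraph (labelledOpen ends fun a => !z a)).Reachable o x) :
    ∃ K : Finset α,
      (∀ z' : α → Bool, (∀ i ∈ K, z' i = z i) →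
        (openGraph (labelledOpen ends z')).Reachable o x ∧
        (openGraph (labelledOpen ends fun a => !z' a)).Reachable o y) ∧
      (∀ z' : α → Bool, (∀ i, i ∉ K → z' i = z i) →
        (openGraph (labelledOpen ends z')).Reachable y w ∧
        (openGraph (labelledOpen ends fun a => !z' a)).Reachable x w) := by
  classical
  obtain ⟨P⟩ := hox
  obtain ⟨Q⟩ := hoy'
  obtain ⟨P'⟩ := hyw
  obtain ⟨Q'⟩ := hxw'
  -- the witness set: open labels on the open `o–x` walk and closed labels on the closed `o–y` walk
  refine ⟨univ.filter fun a => (z a = true ∧ ends a ∈ P.edges) ∨ (z a = false ∧ ends a ∈ Q.edges),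
    ?_, ?_⟩
  · intro z' hz'
    constructor
    · refine reachable_of_walk_of_labels ends z z' P fun a ha he => ?_
      rw [hz' a (mem_filter.2 ⟨mem_univ _, Or.inl ⟨ha, he⟩⟩)]
      exact ha
    · refine reachable_of_walk_of_labels ends (fun a => !z a) (fun a => !z' a) Q fun a ha he => ?_
      have ha0 : z a = false := by simpa using ha
      show (!z' a) = true
      rw [hz' a (mem_filter.2 ⟨mem_univ _, Or.inr ⟨ha0, he⟩⟩), ha0]
      rfl
  · intro z' hz'
    constructor
    · refine reachable_of_walk_of_labels ends z z' P' fun a ha he => ?_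
      have hnot : a ∉ univ.filter fun a =>
          (z a = true ∧ ends a ∈ P.edges) ∨ (z a = false ∧ ends a ∈ Q.edges) := by
        intro hmem
        rcases (mem_filter.1 hmem).2 with ⟨-, heP⟩ | ⟨ha0, -⟩
        · exact hoy (reachable_of_mem_edges_of_mem_edges P P' heP he)
        · rw [ha] at ha0; exact Bool.noConfusion ha0
      rw [hz' a hnot]
      exact ha
    · refine reachable_of_walk_of_labels ends (fun a => !z a) (fun a => !z' a) Q' fun a ha he => ?_
      have ha0 : z a = false := by simpa using ha
      have hnot : a ∉ univ.filter fun a =>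
          (z a = true ∧ ends a ∈ P.edges) ∨ (z a = false ∧ ends a ∈ Q.edges) := by
        intro hmem
        rcases (mem_filter.1 hmem).2 with ⟨ha1, -⟩ | ⟨-, heQ⟩
        · rw [ha0] at ha1; exact Bool.noConfusion ha1
        · exact hox' (reachable_of_mem_edges_of_mem_edges Q Q' heQ he)
      show (!z' a) = true
      rw [hz' a hnot, ha0]
      rfl

/-- **`N_L(H) ≤ N_R⁺(H)`: the configuration-versus-complement crossing count is at most the relaxed
complementary-tripod count** — the corollary of Reimer's butterfly theorem
`|A □ B| ≤ |A ∩ B̄|` (Reimer 2000, Thm. 1.2; van den Berg–Gandolfi 2013, Prop. 2; tree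
`reimer_flip_card_le`) for `A₀ = {o ↔ x open, o ↔ y closed}`, `B₀ = {y ↔ w open, x ↔ w closed}`:
`{ω ∈ ox|yw, ω̄ ∈ oy|xw} ⊆ A₀ □ B₀` (`exists_witness_of_cross`) and
`A₀ ∩ B̄₀ = {o ↔ x ↔ w open, o ↔ y ↔ w closed}`. Since `A₀`, `B₀` are intersections of an
increasing and a decreasing event, the van den Berg–Fiebig special case of Reimer's theorem would
suffice. The sharper inequality `N_L(H) ≤ N_R(H)` (with `tripodComplCount`) is not known.
[cite: ReimerCPC2000, Thm. 1.2] [cite: VandenbergGandolfi2012, §1 Prop. 2] -/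
theorem crossComplCount_le_tripodComplRelaxedCount [DecidableEq V] (ends : α → Sym2 V)
    (o x y w : V) : crossComplCount ends o x y w ≤ tripodComplRelaxedCount ends o x y w := by
  classical
  -- the two certificate events
  set A₀ : Finset (α → Bool) := univ.filter fun z : α → Bool =>
    (openGraph (labelledOpen ends z)).Reachable o x ∧
    (openGraph (labelledOpen ends fun a => !z a)).Reachable o y with hA₀
  set B₀ : Finset (α → Bool) := univ.filter fun z : α → Bool =>
    (openGraph (labelledOpen ends z)).Reachable y w ∧
    (openGraph (labelledOpen ends fun a => !z a)).Reachable x w with hB₀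
  -- Reimer's flip lemma for `A₀, B₀`
  have hR := reimer_flip_card_le A₀ B₀
  -- the crossing set lies in `A₀ □ B₀`
  have h1 : crossComplCount ends o x y w ≤
      (univ.filter fun z : α → Bool => ∃ K : Finset α,
        (∀ z' : α → Bool, (∀ i ∈ K, z' i = z i) → z' ∈ A₀) ∧
        (∀ z' : α → Bool, (∀ i, i ∉ K → z' i = z i) → z' ∈ B₀)).card := by
    unfold crossComplCount
    refine card_le_card fun z hz => ?_
    simp only [mem_filter, mem_univ, true_and] at hz
    obtain ⟨hox, hyw, hoy, hoy', hxw', hox'⟩ := hz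
    obtain ⟨K, hKA, hKB⟩ := exists_witness_of_cross ends o x y w z hox hyw hoy hoy' hxw' hox'
    refine mem_filter.2 ⟨mem_univ _, K, fun z' hz' => ?_, fun z' hz' => ?_⟩
    · rw [hA₀]; exact mem_filter.2 ⟨mem_univ _, hKA z' hz'⟩
    · rw [hB₀]; exact mem_filter.2 ⟨mem_univ _, hKB z' hz'⟩
  -- `A₀ ∩ B̄₀` lies in the relaxed tripod set
  have h3 : (A₀ ∩ B₀.image fun x i => !x i).card ≤ tripodComplRelaxedCount ends o x y w := by
    unfold tripodComplRelaxedCount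
    refine card_le_card fun z hz => ?_
    obtain ⟨hzA, hzB⟩ := mem_inter.1 hz
    rw [hA₀] at hzA
    obtain ⟨hox, hoy'⟩ := (mem_filter.1 hzA).2
    obtain ⟨b, hb, hbz⟩ := mem_image.1 hzB
    rw [hB₀] at hb
    obtain ⟨hyw, hxw'⟩ := (mem_filter.1 hb).2
    have hb1 : (fun a => !z a) = b := by
      funext a; rw [← hbz]; simp
    have hb2 : (fun a => !b a) = z := hbz
    refine mem_filter.2 ⟨mem_univ _, hox, ?_, hoy', ?_⟩
    · rw [hb2] at hxw'; exact hxw'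
    · rw [hb1]; exact hyw
  exact h1.trans (hR.trans h3)

end Counts

end Literature.Probability.Percolation
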